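import Summits.HubbardSuperconductivity.HubbardSuperconductivity.Theses.LiebTwin
import Summits.HubbardSuperconductivity.HubbardSuperconductivity.Theses.EnslavedA1g
import Summits.HubbardSuperconductivity.HubbardSuperconductivity.Theorems.LiebTwinNoOnsiteODLROCouplingTransport
import Summits.HubbardSuperconductivity.HubbardSuperconductivity.Theorems.LiebTwinNoOnsiteODLROHartreeFockEnergyCeiling
import Summits.HubbardSuperconductivity.HubbardSuperconductivity.Theorems.LiebTwinNoOnsiteODLROPencilGainFirstOrder

/-!
# Crux `NoOnsiteODLRO` (stmt-HubbardSuperconductivity-0933; shared by routes `LiebTwin`, `EnslavedA1g`) —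
# SKELETON `Lines/Sketch.lean` (lead c3, rev 1.2, 2026-08-17): Shastry secant + reduced-channel neutralisation,
# the crux as the sub-extensivity of ONE energy difference (idea `Ideas/shastry-secant-reduced-bcs.md`)

The crux: for ALL `U > 0`, `δ ∈ (0,1/2)` and every admissible `(N_L, S^z = 0)`-sector ground-state
sequence `ψ_L` of `hubbardTorus 2 L 1 U`, `S_L := Re⟨ψ_L, P_sᴴ P_s ψ_L⟩ = o(L⁴)` along even `L`
(`P_s = pairField sWave L = √2 Σ_x c_{x↑}c_{x↓} = -√2·etaLower 1`).

LINE. Shastry's order-by-projection coupling `x ↦ H + x·P_sᴴP_s` read as a concave deformation: the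
one-sided Feynman–Hellmann (secant) inequality at `x = 0` — LANDED in the tree as
`Theorems.NoOnsiteODLRO.ReducedChannel.smul_re_expect_le_minEnergyOn_sub` (seat LiebTwin-1,
`LiebTwinNoOnsiteODLROCouplingTransport.lean`) — gives for EVERY unit sector ground state and every `c > 0`
`c · S ≤ E_K(H) − E_K(H − c·P_sᴴP_s)`. With `c = g/L²` the crux is implied, by pure arithmetic, by

* `stub_reducedBCSStability` (OPEN core; the card's transfer target `ReducedBCSStability`, typed on sector
  ENERGIES only — no ground-state vector, no pair window, no `U`-shift, no Falk–Bruch): for all `U > 0`,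
  `δ ∈ (0,1/2)` there is ONE fixed `g > 0` such that the ground-energy GAIN of the repulsive Hubbard torus in
  the sector `(N_L, 0)`, `N_L = 2⌊(1−δ)L²/2⌋`, under the weak REDUCED `s`-wave BCS attraction `−(g/L²)·P_sᴴP_s`
  (`= −(2g/L²)·η₀ᴴη₀`) is `o(L²)` along even `L`.

Two by-product stubs were registered with it in rev 1 and LANDED in wave 1 (not composition pieces; they calibrate the
core), and four helper files of lead c3 followed (all `--supports`): p159834 `LiebTwinNoOnsiteODLROReducedBCSExposure`
(RBS ⇒ the crux for every `s`-wave-attracted model `H_U − (g'/L²)P_sᴴP_s`, `g' < g`), p160024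
`LiebTwinNoOnsiteODLROHartreeFockOnsiteCeiling` (`⟨D⟩_GS ≤ n²/L²`, `S ≤ N²/2`, `S_L/L⁴ ≤ (1−δ)²/2` window-free),
p160165 `LiebTwinNoOnsiteODLROReducedBCSCalibration` (crux ⇔ LOCAL RBS; this stub = the `L`-uniform case), p160422
`LiebTwinNoOnsiteODLROReducedBCSGainApriori` (`0 ≤ G_L(g) ≤ 2g·n²/L²` for `2g ≤ U`). The two wave-1 stubs:

* `stub_hartreeFockEnergyCeiling` — the Hartree–Fock (paired-Fermi-sea) upper bound
  `E_(2n,0)(U) ≤ E_(2n,0)(0) + U·n²/L²` (tree: `re_expect_hubbardTorus_pairedState`, `exists_fermiSet`,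
  `minEnergyOn_szSector_free_eq`). With the landed coupling-transport ceiling at `g = U` it yields the
  WINDOW-FREE ALL-`U` density ceiling `S ≤ 2n² = N²/2`, i.e. `S_L/L⁴ ≤ (1−δ)²/2` (lead c3, helper file), and
  the a-priori size of the gain: `G_L(g) ≤ E(U) − E(U−2g) ≤ 2g·n²/L²` for `2g ≤ U` (the "natural strength
  `O(L²)`" of the card, quantified).
* `stub_pencilGainFirstOrder` — Danskin's first-order upper bound for the gain of a Hermitian pencil on a
  sector: if every unit minimiser `φ` of `H` on `K` has `Re⟨φ,Yφ⟩ ≤ M`, then for every `η > 0` and all small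
  `c > 0`, `E_K(H) − E_K(H − cY) ≤ c(M + η)`. With the tree's selection lemma
  `eventually_uniform_of_noOnsiteODLRO` it shows the crux is EQUIVALENT to the LOCAL form of the core
  (`∀ ε ∃ L₀ ∀ L ∃ g_L > 0 : G_L(g_L) ≤ ε g_L L²`), so the core = crux + an `L`-UNIFORM stability threshold
  of the reduced `s`-channel (lead c3, calibration file); and by the supergradient inequality at `g' < g` the
  core forces `S = o(L⁴)` for every ground state of the MORE attractive models `H_U − (g'/L²)P_sᴴP_s`,
  `g' ∈ [0, g)` (lead c3, exposure file).

Disproof used (Cruxes/NoOnsiteODLRO/Disproof.lean v3): `noOnsiteODLRO_false_without_groundState` (p149867) —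
the secant is the one place `ψ` enters and it needs the eigen-clause (`hground` below is built from it);
p154305 (no rate below `L²`) — the core with an `O(1)` gain gives exactly `S = O(L²)`, with `o(L²)` the
crux, consistent; section (d) (kernel exposure of `K₋`-form bounds) — not applicable: no `(N−2)`-sector,
no window. `-- Targets`: none on this line at registration.
-/

noncomputable section

set_option linter.dupNamespace false

namespace Summit.HubbardSuperconductivity.HubbardSuperconductivity.Cruxes.NoOnsiteODLRO.Sketch

open Matrix Finset Filter
open scoped ComplexOrder
open Literature.Probability.LatticeModels Literature.MathematicalPhysics.QuantumLattice
open Summit.HubbardSuperconductivity.HubbardSuperconductivity.Theorems.NoOnsiteODLRO.ReducedChannel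
  (smul_re_expect_le_minEnergyOn_sub)

/-! ## Stubs -/

/-- STUB 1 (OPEN core — `ReducedBCSStability`, the transfer target of idea `shastry-secant-reduced-bcs`).
For all `U > 0` and `δ ∈ (0,1/2)` there is a fixed `g > 0` such that for every `ε > 0`, eventually in even
`L`, the sector ground energy of `hubbardTorus 2 L 1 U` at `(N_L, S^z = 0)`, `N_L = 2⌊(1−δ)L²/2⌋`, drops by
at most `ε·L²` when the reduced `s`-wave BCS attraction `(g/L²)·P_sᴴP_s` is subtracted:
`E(H_U) − E(H_U − (g/L²)·P_sᴴP_s) ≤ ε L²` ("the uniform `s`-wave Cooper channel of the doped repulsive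
model is non-critical", in energy currency). [Shastry1997, eq. (1); KuboKishi1990, eq. (10) (the `δ = 0`
case at `β = ∞`); BruPedra2013, App. Thm 107] -/
theorem stub_reducedBCSStability :
    ∀ (U δ : ℝ), 0 < U → δ ∈ Set.Ioo (0 : ℝ) (1 / 2) →
      ∃ g : ℝ, 0 < g ∧ ∀ ε : ℝ, 0 < ε → ∃ L₀ : ℕ, ∀ (L : ℕ) [NeZero L], Even L → L₀ ≤ L →
        (hubbardTorus 2 L 1 U).minEnergyOn
              (szSector (Λ := FermionTorus 2 L) (2 * ⌊(1 - δ) * (L : ℝ) ^ 2 / 2⌋₊) 0) -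
            (hubbardTorus 2 L 1 U -
                ((g / (L : ℝ) ^ 2 : ℝ) : ℂ) • ((pairField sWave L)ᴴ * pairField sWave L)).minEnergyOn
              (szSector (Λ := FermionTorus 2 L) (2 * ⌊(1 - δ) * (L : ℝ) ^ 2 / 2⌋₊) 0) ≤
          ε * (L : ℝ) ^ 2 := by
  sorry

/-- STUB 2 (by-product, LANDED p158799 — the HARTREE–FOCK ENERGY CEILING). For `L ≥ 3`, every real `U` and
every `n ≤ L²`: `E_(2n,0)(U) ≤ E_(2n,0)(0) + U·n²/L²`, `E_(2n,0)(V) = minEnergyOn (hubbardTorus 2 L 1 V)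
(szSector (2n) 0)` — the paired Fermi sea over a Fermi set of `n` lowest band levels is a unit vector of the
sector with energy EXACTLY `2Σ_F ε + U n²/L²` (`re_expect_hubbardTorus_pairedState`), and `2Σ_F ε` is the free
sector floor (`minEnergyOn_szSector_free_eq`). [Penn1966, §II; BCS1957, §II; LiebLoss2001, Thm 1.14] -/
theorem stub_hartreeFockEnergyCeiling :
    ∀ (L : ℕ) [NeZero L], 3 ≤ L → ∀ (U : ℝ) (n : ℕ), n ≤ L ^ 2 →
      (hubbardTorus 2 L 1 U).minEnergyOn (szSector (Λ := FermionTorus 2 L) (2 * n) 0) ≤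
        (hubbardTorus 2 L 1 0).minEnergyOn (szSector (Λ := FermionTorus 2 L) (2 * n) 0) +
          U * ((n : ℝ) ^ 2 / (L : ℝ) ^ 2) :=
  -- LANDED (wave 1, worker A): p158799, Theorems/LiebTwinNoOnsiteODLROHartreeFockEnergyCeiling.lean
  Summit.HubbardSuperconductivity.HubbardSuperconductivity.Theorems.NoOnsiteODLRO.HartreeFock.stub_hartreeFockEnergyCeiling

/-- STUB 3 (by-product, LANDED p159261 — DANSKIN'S FIRST-ORDER GAIN BOUND for a Hermitian pencil on a sector).
For Hermitian `H`, `Y` on a finite index type, a sector `K ≠ ⊥` and a real `M` bounding `Re⟨φ, Yφ⟩` over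
all unit minimisers `φ` of `H` on `K`: for every `η > 0` there is `c₀ > 0` with
`E_K(H) − E_K(H − c·Y) ≤ c·(M + η)` for all `0 < c ≤ c₀` (the right derivative of the concave pencil energy
at `0` is `−max_GS Re⟨Yφ,φ⟩`; compactness of the unit sphere of `K`). [Kato1966, §II.5.4 (Thm 5.4,
first-order degenerate perturbation); Danskin1966] -/
theorem stub_pencilGainFirstOrder :
    ∀ (m : Type) [Fintype m] [DecidableEq m] (H Y : Matrix m m ℂ), H.IsHermitian → Y.IsHermitian →
      ∀ (K : Submodule ℂ (m → ℂ)), K ≠ ⊥ →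
        ∀ M : ℝ,
          (∀ φ ∈ K, star φ ⬝ᵥ φ = 1 → (star φ ⬝ᵥ H *ᵥ φ).re = H.minEnergyOn K →
              (star φ ⬝ᵥ Y *ᵥ φ).re ≤ M) →
            ∀ η : ℝ, 0 < η → ∃ c₀ : ℝ, 0 < c₀ ∧ ∀ c : ℝ, 0 < c → c ≤ c₀ →
              H.minEnergyOn K - (H - (c : ℂ) • Y).minEnergyOn K ≤ c * (M + η) :=
  -- LANDED (wave 1, worker C): p159261, Theorems/LiebTwinNoOnsiteODLROPencilGainFirstOrder.lean
  Summit.HubbardSuperconductivity.HubbardSuperconductivity.Theorems.NoOnsiteODLRO.Danskin.stub_pencilGainFirstOrder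

/-! ## Composition -/

/-- COMPOSITION, hypothesis form (sorry-free, axioms `propext/Classical.choice/Quot.sound` only):
Stub 1 → the body of the crux `NoOnsiteODLRO` VERBATIM. Per sequence and `ε > 0`: take the channel strength
`g` of Stub 1 and its threshold `L₀` at tolerance `ε·g`; at an even `L ≥ L₀` the landed on-site secant
`smul_re_expect_le_minEnergyOn_sub` with `c = g/L²` gives `(g/L²)·S_L ≤ gain ≤ ε g L²`, i.e. `S_L ≤ ε L⁴`. -/
theorem NoOnsiteODLRO_of_stubs
    (hRBS : ∀ (U δ : ℝ), 0 < U → δ ∈ Set.Ioo (0 : ℝ) (1 / 2) →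
      ∃ g : ℝ, 0 < g ∧ ∀ ε : ℝ, 0 < ε → ∃ L₀ : ℕ, ∀ (L : ℕ) [NeZero L], Even L → L₀ ≤ L →
        (hubbardTorus 2 L 1 U).minEnergyOn
              (szSector (Λ := FermionTorus 2 L) (2 * ⌊(1 - δ) * (L : ℝ) ^ 2 / 2⌋₊) 0) -
            (hubbardTorus 2 L 1 U -
                ((g / (L : ℝ) ^ 2 : ℝ) : ℂ) • ((pairField sWave L)ᴴ * pairField sWave L)).minEnergyOn
              (szSector (Λ := FermionTorus 2 L) (2 * ⌊(1 - δ) * (L : ℝ) ^ 2 / 2⌋₊) 0) ≤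
          ε * (L : ℝ) ^ 2) :
    -- the body of `Theses.LiebTwin.NoOnsiteODLRO` (= `Theses.EnslavedA1g.NoOnsiteODLRO`), verbatim:
    ∀ (U δ : ℝ), 0 < U → δ ∈ Set.Ioo (0 : ℝ) (1 / 2) →
      ∀ (N : ℕ → ℕ) (ψ : ∀ L, Fock (Orb (FermionTorus 2 L))),
        (∀ L, Even L → N L = 2 * ⌊(1 - δ) * (L : ℝ) ^ 2 / 2⌋₊ ∧ star (ψ L) ⬝ᵥ ψ L = 1 ∧
            IsGroundStateInSector (hubbardTorus 2 L 1 U) (N L) 0 (ψ L)) →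
          ∀ ε : ℝ, 0 < ε → ∃ L₀ : ℕ, ∀ (L : ℕ) [NeZero L], Even L → L₀ ≤ L →
            (expect (Matrix.conjTranspose (pairField sWave L) * pairField sWave L) (ψ L)).re / (L : ℝ) ^ 4 ≤ ε := by
  intro U δ hU hδ N ψ hyp ε hε
  obtain ⟨g, hg, hL₀⟩ := hRBS U δ hU hδ
  obtain ⟨L₀, hL₀⟩ := hL₀ (ε * g) (mul_pos hε hg)
  refine ⟨L₀, fun L _ hEv hL => ?_⟩
  obtain ⟨hN, hψ1, hmem, -, heig⟩ := hyp L hEv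
  have hgain := hL₀ L hEv hL
  rw [← hN] at hgain
  -- the on-site secant at `c = g / L²`
  have hH : (hubbardTorus 2 L 1 U).IsHermitian := LiebThm1.hamiltonian_isHermitian (fermionTorusGraph 2 L) 1 U
  have hground : (star (ψ L) ⬝ᵥ (hubbardTorus 2 L 1 U) *ᵥ (ψ L)).re =
      (hubbardTorus 2 L 1 U).minEnergyOn (szSector (Λ := FermionTorus 2 L) (N L) 0) := by
    rw [heig, dotProduct_smul, hψ1, smul_eq_mul, mul_one, Complex.ofReal_re]
  have hsec := smul_re_expect_le_minEnergyOn_sub hH (pairField sWave L) (g / (L : ℝ) ^ 2)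
    (szSector (Λ := FermionTorus 2 L) (N L) 0) hmem hψ1 hground
  have hL1 : (0 : ℝ) < (L : ℝ) := by exact_mod_cast Nat.pos_of_ne_zero (NeZero.ne L)
  have hL2 : (0 : ℝ) < (L : ℝ) ^ 2 := by positivity
  have hL4 : (0 : ℝ) < (L : ℝ) ^ 4 := by positivity
  -- `(g/L²)·S ≤ ε g L²`, hence `S ≤ ε L⁴`
  set S := (star (ψ L) ⬝ᵥ ((pairField sWave L)ᴴ * pairField sWave L) *ᵥ (ψ L)).re with hS
  have key : g / (L : ℝ) ^ 2 * S ≤ ε * g * (L : ℝ) ^ 2 := hsec.trans hgain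
  have key2 : g * S ≤ g * (ε * (L : ℝ) ^ 4) := by
    have h := mul_le_mul_of_nonneg_left key hL2.le
    calc g * S = (L : ℝ) ^ 2 * (g / (L : ℝ) ^ 2 * S) := by field_simp
      _ ≤ (L : ℝ) ^ 2 * (ε * g * (L : ℝ) ^ 2) := h
      _ = g * (ε * (L : ℝ) ^ 4) := by ring
  have hSle : S ≤ ε * (L : ℝ) ^ 4 := le_of_mul_le_mul_left key2 hg
  change S / (L : ℝ) ^ 4 ≤ ε
  rw [div_le_iff₀ hL4]
  exact hSle

/-- THE SKELETON THEOREM — the crux `NoOnsiteODLRO` BY NAME (route `LiebTwin`'s decl; the `EnslavedA1g` copy is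
`Iff.rfl`-equal): the registered core stub fed into `NoOnsiteODLRO_of_stubs`. Its only non-whitelisted axiom is
the stub's `sorryAx`; it becomes a proof of the crux the moment `stub_reducedBCSStability` is a theorem. -/
theorem NoOnsiteODLRO_of :
    Summit.HubbardSuperconductivity.HubbardSuperconductivity.Theses.LiebTwin.NoOnsiteODLRO :=
  NoOnsiteODLRO_of_stubs stub_reducedBCSStability

/-- The same skeleton theorem under the gate's canonical name and the `EnslavedA1g` copy of the crux decl
(shared item; the two route copies are `Iff.rfl`-equal). -/
theorem NoOnsiteODLRO_proof :
    Summit.HubbardSuperconductivity.HubbardSuperconductivity.Theses.EnslavedA1g.NoOnsiteODLRO :=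
  NoOnsiteODLRO_of_stubs stub_reducedBCSStability

end Summit.HubbardSuperconductivity.HubbardSuperconductivity.Cruxes.NoOnsiteODLRO.Sketch

end
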